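import Literature.NumberTheory.LFunctions.LargeValuesJutilaKernel
import Literature.NumberTheory.LFunctions.JutilaPairCorrelationBound
import HarnessLib

/-!
# Jutila 1977, Theorem (1.4) — discharged

NOT RH-BEARING (D-0040; bears_on LADDER-RH §4 HELD `DensityLadder`): a large-values / zero-density
result counts zeros off the critical line, it never empties the strip
(`Literature.Barriers.RiemannHypothesis.LindelofBacklund`); nothing in this file bears on the truth of RH.

Topic `NumberTheory/LFunctions`. M. Jutila, *Zero-density estimates for `L`-functions*, Acta Arith. 32
(1977) 55–62, Theorem, estimate (1.4) (p. 56, case (iii): `q = 1`):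
`R ≪_{ε,k} (GNV^{−2} + TG^{3−1/k}N^{1−1/k}V^{−6+2/k} + T(G⁴N²V^{−8})^k) T^ε`, typed AS PRINTED as the named
fact `Jutila1977_theorem_1_4` (`LargeValuesLongPolynomials.lean`), is PROVED here by composing the
landed chain of the rh-crit/gm F3 sub-cell:

* `Jutila1977.sum_norm_coefB_pairs_le` (`JutilaPairCorrelationBound.lean`, KERNEL-B): Jutila §3
  (3.1)–(3.2) — the off-diagonal pair-correlation bound, with Guth–Maynard's Lemma 6.2 as the
  reflection principle and Heath-Brown's theorem in place of Jutila's Lemma 3;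
* `Jutila1977.theorem_1_4_of_pairBound` (`LargeValuesJutilaKernel.lean`, KERNEL-A: the
  Halász–Montgomery inequality (3.1) in sum form and the solution for `R` ⇒ (1.2) at `q = 1`, `σ = 0`;
  then `Jutila1977LargeValuesReduction.lean`: `σ_r ≥ 0` as printed ⇒ `σ = 0`, and
  `LargeValuesJutilaSubdivision.lean`: Huxley's subdivision (1.2) ⇒ (1.4));
* `Jutila1977_largeValues_of_theorem_1_4` (`LargeValuesLongPolynomials.lean`): Teräväinen's form of
  (1.4), the leaf used by Guth–Maynard's Proposition 12.1.

No definition and no named fact is introduced (net debt −1: `Jutila1977_theorem_1_4` discharged).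

## References

* M. Jutila, *Zero-density estimates for `L`-functions*, Acta Arith. 32 (1977), 55–62, Theorem (1.4),
  p. 56; §§2–3. [key `Jutila1977`]
* L. Guth, J. Maynard, *New large value estimates for Dirichlet polynomials*, Ann. of Math. (2) 203
  (2026) = arXiv:2405.20552, §12 (proof of Proposition 12.1: "Jutila's large values estimate
  [Ju, Theorem (1.4)] with `k = 3`"). [key `GuthMaynard2026`]
-/

namespace Literature.NumberTheory.LFunctions

/-- **Jutila 1977, Theorem (1.4), PROVED**: the named fact `Jutila1977_theorem_1_4` (case (iii), `q = 1`,
as printed on p. 56) holds — KERNEL-B (`Jutila1977.sum_norm_coefB_pairs_le`) fed into KERNEL-A and the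
landed outer chain (`Jutila1977.theorem_1_4_of_pairBound`). [cite: Jutila1977, Theorem (1.4), p. 56] -/
theorem Jutila1977_theorem_1_4_holds : Jutila1977_theorem_1_4 :=
  Jutila1977.theorem_1_4_of_pairBound Jutila1977.sum_norm_coefB_pairs_le

/-- **Teräväinen's form of Jutila's (1.4), PROVED** (the leaf `Jutila1977_largeValues` used by
Guth–Maynard's Proposition 12.1). [cite: Jutila1977, Theorem (1.4), p. 56] [cite: Teravainen2016, Lemma 7] -/
theorem Jutila1977_largeValues_holds : Jutila1977_largeValues :=
  Jutila1977_largeValues_of_theorem_1_4 Jutila1977_theorem_1_4_holds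

end Literature.NumberTheory.LFunctions
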